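import Summits.Ventures.LatticeQCDFlow.Scoring.U1TorusTopologicalSusceptibilityTwelfth
import Literature.Analysis.FunctionSpaces.BesselIIntegralSeries
import HarnessLib

/-!
# The finite-volume law of the topological susceptibility of 2-d `U(1)`: `χ_t(L, β) → ⟨θ²⟩_β/(4π²)` exponentially fast

HONEST FRAMING: exact (Metropolis-corrected) sampling algorithms for lattice gauge theory;
figures of merit are autocorrelation/cost numbers at stated couplings and volumes; no
continuum-physics claim.

Venture `LatticeQCDFlow` (cell pub-lqcd), sub-topic `Scoring`; FANOUT row 5 (`s0-sun-a`), GEN-14.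
NEW WORK of the cell (placement rule).  `Scoring/U1TorusTopologicalSusceptibilityTwelfth.lean`:
`χ_t(L, β) = 1/12 + (1/(4π²))·Σ_n[2 I_{|n|}^{V−1} κ_n − (V−1) I_{|n|}^{V−2} σ_n²]/Σ_n I_{|n|}^V`, `V = L²`.
The `n = 0` terms dominate: `σ_0 = Σ_m (−1)^m I_{|m|}/m = 0` by antisymmetry, the denominator is
`I₀^V (1 + O(t^{V−1}))` and every `n ≠ 0` term carries a factor `I_{|n|}^{V−2} ≤ I₁^{V−2}`
(`t = I₁(β)/I₀(β) < 1`).  Hence, for `β > 0` and every `L ≥ 2`: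

* `sigmaSeries_zero` — `σ_0(β) = 0`;
* **`abs_u1TopSusceptibility_sub_le`** —
  `|χ_t(L, β) − χ_∞(β)| ≤ (V + 3) e^{3β} t^{V−3} / (4π²)`,
  `χ_∞(β) = 1/12 + κ_0(β)/(2π² I₀(β))`, `κ_0(β) = Σ_{m≠0} (−1)^m I_{|m|}(β)/m²`;
* **`chiInf_eq_single_plaquette`** — `χ_∞(β) = ⟨θ²⟩_β/(4π²)`,
  `⟨θ²⟩_β = ∫_{−π}^{π} θ² e^{β cos θ} dθ / (2π I₀(β))`: the infinite-volume susceptibility is the second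
  moment of ONE plaquette angle in units of `2π` (independent plaquettes), by `cosMoment_eq_tsum` at
  `n = 0`;
* **`tendsto_u1TopSusceptibility`** — `χ_t(L+2, β) → χ_∞(β)` as `L → ∞`.

Elementary given the parents (`Σ_m I_{|m|}(β) = e^β`, `I_n ≤ I₁ ≤ I₀` for `n ≥ 1`); nothing is cited.
-/

noncomputable section

open MeasureTheory Set Real Filter Topology Finset
open scoped ENNReal
open Literature.Analysis.FunctionSpaces
open Literature.MathematicalPhysics.QuantumFieldTheory
open Literature.MathematicalPhysics.QuantumLattice (u1Rep)
open Summit.Ventures.LatticeQCDFlow.Theory2.Lattice (topCharge)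

namespace Summit.Ventures.LatticeQCDFlow.Scoring

variable (β : ℝ)

/-! ### 1. `σ_0 = 0` and the bound on the `n ≠ 0` terms -/

/-- **`σ_0(β) = Σ_m (−1)^m I_{|m|}(β)/m = 0`** (the summand is odd in `m`). -/
theorem sigmaSeries_zero :
    ∑' m : ℤ, besselI m.natAbs β * ((-1 : ℝ) ^ ((0 : ℤ) + m) / (((0 : ℤ) + m : ℤ) : ℝ)) = 0 := by
  set f : ℤ → ℝ := fun m => besselI m.natAbs β * ((-1 : ℝ) ^ ((0 : ℤ) + m) / (((0 : ℤ) + m : ℤ) : ℝ))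
    with hf
  have hodd : ∀ m, f (-m) = -f m := fun m => by
    simp only [hf, zero_add, Int.natAbs_neg, Int.cast_neg]
    rcases Int.even_or_odd m with h | h
    · rw [h.neg.neg_one_zpow, h.neg_one_zpow]; ring
    · rw [h.neg.neg_one_zpow, h.neg_one_zpow]; ring
  have h1 : ∑' m, f m = ∑' m, f (-m) := ((Equiv.neg ℤ).tsum_eq f).symm
  have h2 : ∑' m, f (-m) = -∑' m, f m := by
    rw [← tsum_neg]; exact tsum_congr fun m => hodd m
  have h3 : ∑' m, f m = 0 := by linarith
  exact h3

/-- `I_{|n|}(β) ≤ I₁(β)` for `n ≠ 0`, `β > 0`. -/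
theorem besselI_natAbs_le_one {β : ℝ} (hβ : 0 < β) {n : ℤ} (hn : n ≠ 0) :
    besselI n.natAbs β ≤ besselI 1 β :=
  besselI_antitone hβ.le (by omega)

/-- **The `n ≠ 0` terms**: for `k ≥ 1`, `|g_n| ≤ G` and `β > 0`,
`|Σ_{n≠0} I_{|n|}^k g_n| ≤ I₁^{k−1} G e^β` (using `I_{|n|} ≤ I₁` off `0` and `Σ_n I_{|n|} = e^β`). -/
theorem abs_tsum_ite_pow_mul_le {β : ℝ} (hβ : 0 < β) (k : ℕ) {g : ℤ → ℝ} {G : ℝ}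
    (hg : ∀ n, |g n| ≤ G) (hs : Summable fun n : ℤ => besselI n.natAbs β ^ (k + 1) * g n) :
    |∑' n : ℤ, (if n = 0 then 0 else besselI n.natAbs β ^ (k + 1) * g n)| ≤
      besselI 1 β ^ k * G * Real.exp β := by
  have hG : 0 ≤ G := (abs_nonneg _).trans (hg 0)
  have hI0 : ∀ n : ℤ, 0 ≤ besselI n.natAbs β := fun n => besselI_nonneg _ hβ.le
  have hI1 : 0 ≤ besselI 1 β := besselI_nonneg _ hβ.le
  have hsi : Summable fun n : ℤ => (if n = 0 then 0 else besselI n.natAbs β ^ (k + 1) * g n) := by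
    refine Summable.of_norm_bounded hs.abs fun n => ?_
    split_ifs
    · rw [norm_zero]; exact abs_nonneg _
    · exact le_of_eq (Real.norm_eq_abs _)
  have hmaj : Summable fun n : ℤ => besselI 1 β ^ k * G * besselI n.natAbs β :=
    (summable_besselI_natAbs β).mul_left _
  have hle : ∀ n : ℤ, |(if n = 0 then 0 else besselI n.natAbs β ^ (k + 1) * g n)| ≤
      besselI 1 β ^ k * G * besselI n.natAbs β := fun n => by
    split_ifs with h
    · rw [abs_zero]; exact mul_nonneg (mul_nonneg (pow_nonneg hI1 _) hG) (hI0 n)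
    · rw [abs_mul, abs_pow, abs_of_nonneg (hI0 n), pow_succ]
      have h1 : besselI n.natAbs β ^ k ≤ besselI 1 β ^ k :=
        pow_le_pow_left₀ (hI0 n) (besselI_natAbs_le_one hβ h) k
      calc besselI n.natAbs β ^ k * besselI n.natAbs β * |g n|
          ≤ besselI 1 β ^ k * besselI n.natAbs β * G :=
            mul_le_mul (mul_le_mul_of_nonneg_right h1 (hI0 n)) (hg n) (abs_nonneg _)
              (mul_nonneg (pow_nonneg hI1 _) (hI0 n))
        _ = besselI 1 β ^ k * G * besselI n.natAbs β := by ring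
  have hn := norm_tsum_le_tsum_norm (f := fun n : ℤ =>
    (if n = 0 then 0 else besselI n.natAbs β ^ (k + 1) * g n)) (by simpa [← Real.norm_eq_abs] using hsi.abs)
  simp only [Real.norm_eq_abs] at hn
  refine hn.trans ((hsi.abs.tsum_le_tsum hle hmaj).trans ?_)
  rw [tsum_mul_left, (hasSum_besselI_natAbs β).tsum_eq]

/-! ### 2. The finite-volume law -/

variable {L : ℕ} [NeZero L]

set_option maxHeartbeats 800000 in
/-- **THE FINITE-VOLUME LAW OF THE TOPOLOGICAL SUSCEPTIBILITY.**  For `β > 0` and every `L ≥ 2`, with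
`V = L²`, `t = I₁(β)/I₀(β)` and `κ_0(β) = Σ_m (−1)^m I_{|m|}(β)/m²` (`m = 0` term `0`):

  `|χ_t(L, β) − (1/12 + κ_0(β)/(2π² I₀(β)))| ≤ (V + 3) e^{3β} t^{V−3} / (4π²)`. -/
theorem abs_u1TopSusceptibility_sub_le {β : ℝ} (hβ : 0 < β) (hL : 2 ≤ L) :
    |u1TopSusceptibility L β -
        (1 / 12 + (∑' m : ℤ, besselI m.natAbs β * ((-1 : ℝ) ^ ((0 : ℤ) + m) / (((0 : ℤ) + m : ℤ) : ℝ) ^ 2)) /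
          (2 * π ^ 2 * besselI 0 β))| ≤
      ((L : ℝ) ^ 2 + 3) * Real.exp (3 * β) * (besselI 1 β / besselI 0 β) ^ (L ^ 2 - 3) / (4 * π ^ 2) := by
  have hV4 : 4 ≤ L ^ 2 := le_trans (by norm_num) (Nat.pow_le_pow_left hL 2)
  obtain ⟨w, hw⟩ : ∃ w, L ^ 2 = w + 3 := ⟨L ^ 2 - 3, by omega⟩
  have hI0 : 0 < besselI 0 β := besselI_pos 0 hβ
  have hI1 : 0 < besselI 1 β := besselI_pos 1 hβ
  have hI10 : besselI 1 β ≤ besselI 0 β := besselI_le_besselI_zero 1 β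
  have h1I0 : 1 ≤ besselI 0 β := one_le_besselI_zero β
  have hπ : 0 < π := Real.pi_pos
  -- names
  set I0 := besselI 0 β with hI0d
  set I1 := besselI 1 β with hI1d
  set κ : ℤ → ℝ := fun n => ∑' k : ℤ, besselI k.natAbs β * ((-1 : ℝ) ^ (n + k) / ((n + k : ℤ) : ℝ) ^ 2)
    with hκ
  set σ : ℤ → ℝ := fun n => ∑' k : ℤ, besselI k.natAbs β * ((-1 : ℝ) ^ (n + k) / (n + k : ℤ)) with hσ
  set F : ℤ → ℝ := fun n => 2 * besselI n.natAbs β ^ (w + 2) * κ n -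
    (w + 2 : ℕ) * besselI n.natAbs β ^ (w + 1) * σ n ^ 2 with hF
  set E := Real.exp β with hE
  have habsβ : |β| = β := abs_of_pos hβ
  have hκb : ∀ n, |κ n| ≤ E := fun n => by
    have := abs_kappaSeries_le β n; rwa [habsβ] at this
  have hσb : ∀ n, |σ n| ≤ E := fun n => by
    have := abs_sigmaSeries_le β n; rwa [habsβ] at this
  have hE0 : 0 ≤ E := (Real.exp_pos β).le
  have hσ0 : σ 0 = 0 := sigmaSeries_zero β
  -- the formula
  rw [u1TopSusceptibility_eq_twelfth_add β hL, hw, show w + 3 - 1 = w + 2 from rfl,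
    show w + 3 - 2 = w + 1 from rfl]
  -- split off the `n = 0` terms
  have hFs : Summable F := summable_correction_term β w
  have hZs : Summable fun n : ℤ => besselI n.natAbs β ^ (w + 3) := summable_besselI_natAbs_pow_succ β (w + 2)
  have hMser : ∑' n, F n = 2 * I0 ^ (w + 2) * κ 0 + ∑' n, (if n = 0 then 0 else F n) := by
    rw [hFs.tsum_eq_add_tsum_ite 0]
    congr 1
    rw [hF]; simp only [Int.natAbs_zero, hσ0]; rw [← hI0d]; ring
  have hZ : ∑' n : ℤ, besselI n.natAbs β ^ (w + 3) =
      I0 ^ (w + 3) + ∑' n : ℤ, (if n = 0 then 0 else besselI n.natAbs β ^ (w + 3)) := by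
    rw [hZs.tsum_eq_add_tsum_ite 0]; simp [hI0d]
  -- bounds on the rests
  set R := ∑' n, (if n = 0 then 0 else F n) with hR
  set Z' := ∑' n : ℤ, (if n = 0 then 0 else besselI n.natAbs β ^ (w + 3)) with hZ'
  have hs1 : Summable fun n : ℤ => besselI n.natAbs β ^ (w + 2) * (2 * κ n) := by
    have h0 : Summable fun n : ℤ => 2 * E * besselI n.natAbs β ^ (w + 2) :=
      (summable_besselI_natAbs_pow_succ β (w + 1)).mul_left (2 * E)
    refine Summable.of_norm_bounded h0 fun n => ?_
    rw [Real.norm_eq_abs, abs_mul, abs_mul, abs_two, abs_pow, abs_of_nonneg (besselI_nonneg _ hβ.le)]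
    have hp := pow_nonneg (besselI_nonneg n.natAbs hβ.le) (w + 2)
    calc besselI n.natAbs β ^ (w + 2) * (2 * |κ n|) ≤ besselI n.natAbs β ^ (w + 2) * (2 * E) :=
          mul_le_mul_of_nonneg_left (by linarith [hκb n]) hp
      _ = 2 * E * besselI n.natAbs β ^ (w + 2) := by ring
  have hs2 : Summable fun n : ℤ => besselI n.natAbs β ^ (w + 1) * (((w + 2 : ℕ) : ℝ) * σ n ^ 2) := by
    have h0 : Summable fun n : ℤ => ((w + 2 : ℕ) : ℝ) * E ^ 2 * besselI n.natAbs β ^ (w + 1) :=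
      (summable_besselI_natAbs_pow_succ β w).mul_left (((w + 2 : ℕ) : ℝ) * E ^ 2)
    refine Summable.of_norm_bounded h0 fun n => ?_
    rw [Real.norm_eq_abs, abs_mul, abs_mul, abs_pow, abs_of_nonneg (besselI_nonneg _ hβ.le),
      Nat.abs_cast, abs_pow]
    have h2 : |σ n| ^ 2 ≤ E ^ 2 := pow_le_pow_left₀ (abs_nonneg _) (hσb n) 2
    have hp := pow_nonneg (besselI_nonneg n.natAbs hβ.le) (w + 1)
    calc besselI n.natAbs β ^ (w + 1) * (((w + 2 : ℕ) : ℝ) * |σ n| ^ 2)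
        ≤ besselI n.natAbs β ^ (w + 1) * (((w + 2 : ℕ) : ℝ) * E ^ 2) :=
          mul_le_mul_of_nonneg_left (mul_le_mul_of_nonneg_left h2 (by positivity)) hp
      _ = ((w + 2 : ℕ) : ℝ) * E ^ 2 * besselI n.natAbs β ^ (w + 1) := by ring
  have hR_eq : R = ∑' n, (if n = 0 then 0 else besselI n.natAbs β ^ (w + 2) * (2 * κ n)) -
      ∑' n, (if n = 0 then 0 else besselI n.natAbs β ^ (w + 1) * (((w + 2 : ℕ) : ℝ) * σ n ^ 2)) := by
    rw [hR, ← Summable.tsum_sub]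
    · refine tsum_congr fun n => ?_
      split_ifs
      · simp
      · rw [hF]; ring
    · exact Summable.of_norm_bounded hs1.abs fun n => by
        split_ifs
        · rw [norm_zero]; exact abs_nonneg _
        · exact le_of_eq (Real.norm_eq_abs _)
    · exact Summable.of_norm_bounded hs2.abs fun n => by
        split_ifs
        · rw [norm_zero]; exact abs_nonneg _
        · exact le_of_eq (Real.norm_eq_abs _)
  have hRb : |R| ≤ I1 ^ (w + 1) * (2 * E) * E + I1 ^ w * ((w + 2 : ℕ) * E ^ 2) * E := by
    rw [hR_eq]
    refine (abs_sub _ _).trans (add_le_add ?_ ?_)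
    · exact abs_tsum_ite_pow_mul_le hβ (w + 1) (fun n => by
        rw [abs_mul, abs_two]; linarith [hκb n]) hs1
    · exact abs_tsum_ite_pow_mul_le hβ w (fun n => by
        rw [abs_mul, Nat.abs_cast, abs_pow, sq_abs]
        have : σ n ^ 2 ≤ E ^ 2 := by
          rw [← sq_abs]; exact pow_le_pow_left₀ (abs_nonneg _) (hσb n) 2
        exact mul_le_mul_of_nonneg_left this (by positivity)) hs2
  have hZ'b : |Z'| ≤ I1 ^ (w + 2) * 1 * E := by
    have h := abs_tsum_ite_pow_mul_le hβ (w + 2) (g := fun _ => (1 : ℝ)) (G := 1) (fun _ => by simp)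
      (by simpa using hZs)
    have e : (∑' n : ℤ, (if n = 0 then 0 else besselI n.natAbs β ^ (w + 2 + 1) * (1 : ℝ))) = Z' := by
      rw [hZ']; refine tsum_congr fun n => ?_; split_ifs <;> simp
    rwa [e] at h
  have hZ'0 : 0 ≤ Z' := tsum_nonneg fun n => by
    split_ifs; exacts [le_rfl, pow_nonneg (besselI_nonneg _ hβ.le) _]
  have hκ0 := hκb 0
  -- the difference
  have hZpos : 0 < I0 ^ (w + 3) + Z' := by positivity
  rw [hMser, hZ]
  have hdiff : 1 / 12 + 1 / (4 * π ^ 2) * (2 * I0 ^ (w + 2) * κ 0 + R) / (I0 ^ (w + 3) + Z') -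
      (1 / 12 + κ 0 / (2 * π ^ 2 * I0)) =
      (R * I0 - 2 * κ 0 * Z') / (4 * π ^ 2 * ((I0 ^ (w + 3) + Z') * I0)) := by
    field_simp
    ring
  have hκ0' : (∑' m : ℤ, besselI m.natAbs β * ((-1 : ℝ) ^ ((0 : ℤ) + m) / (((0 : ℤ) + m : ℤ) : ℝ) ^ 2)) = κ 0 := by
    rw [hκ]
  rw [hκ0', hdiff, abs_div, abs_of_pos (by positivity : (0 : ℝ) < 4 * π ^ 2 * ((I0 ^ (w + 3) + Z') * I0))]
  -- numerator and denominator
  have hnum : |R * I0 - 2 * κ 0 * Z'| ≤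
      (I1 ^ (w + 1) * (2 * E) * E + I1 ^ w * ((w + 2 : ℕ) * E ^ 2) * E) * I0 + 2 * E * (I1 ^ (w + 2) * E) := by
    refine (abs_sub _ _).trans (add_le_add ?_ ?_)
    · rw [abs_mul, abs_of_pos hI0]; exact mul_le_mul_of_nonneg_right hRb hI0.le
    · rw [abs_mul, abs_mul, abs_two, abs_of_nonneg hZ'0]
      calc 2 * |κ 0| * Z' ≤ 2 * E * (I1 ^ (w + 2) * 1 * E) :=
            mul_le_mul (by linarith) (le_trans (le_abs_self _) hZ'b) hZ'0 (by positivity)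
        _ = 2 * E * (I1 ^ (w + 2) * E) := by ring
  have hden : I0 ^ (w + 3) * I0 ≤ (I0 ^ (w + 3) + Z') * I0 := by nlinarith [pow_pos hI0 (w + 3)]
  rw [div_le_div_iff₀ (by positivity) (by positivity)]
  -- reduce to `t = I1/I0`
  have ht : besselI 1 β / besselI 0 β = I1 / I0 := rfl
  rw [show w + 3 - 3 = w from rfl, div_pow]
  have hE1 : 1 ≤ E := by rw [hE]; exact Real.one_le_exp hβ.le
  have hE3 : Real.exp (3 * β) = E ^ 3 := by rw [hE, ← Real.exp_nat_mul]; norm_num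
  rw [hE3]
  have hwc : ((w + 2 : ℕ) : ℝ) = w + 2 := by push_cast; ring
  rw [hwc] at hnum
  have hL2 : ((L : ℝ)) ^ 2 = w + 3 := by exact_mod_cast hw
  rw [hL2]
  -- everything is a polynomial inequality in `I0 ≥ 1 ≥ ... `, `0 < I1 ≤ I0`, `E ≥ 1`
  have hI1w : 0 < I1 ^ w := pow_pos hI1 w
  have hI0w : 0 < I0 ^ w := pow_pos hI0 w
  have hI1le : I1 ^ w ≤ I0 ^ w := pow_le_pow_left₀ hI1.le hI10 w
  have key : |R * I0 - 2 * κ 0 * Z'| * (4 * π ^ 2 * I0 ^ w) ≤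
      ((w + 3 : ℝ) + 3) * E ^ 3 * I1 ^ w * (4 * π ^ 2 * ((I0 ^ (w + 3) + Z') * I0)) := by
    have hA : |R * I0 - 2 * κ 0 * Z'| ≤ ((w : ℝ) + 6) * E ^ 3 * I1 ^ w * I0 ^ 3 := by
      have e1 : I1 ^ (w + 1) * (2 * E) * E * I0 = 2 * E ^ 2 * (I1 ^ w * (I1 * I0)) := by ring
      have e2 : I1 ^ w * ((w + 2) * E ^ 2) * E * I0 = (w + 2) * E ^ 3 * (I1 ^ w * I0) := by ring
      have e3 : 2 * E * (I1 ^ (w + 2) * E) = 2 * E ^ 2 * (I1 ^ w * (I1 * I1)) := by ring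
      have hI02 : I0 ^ 2 ≤ I0 ^ 3 := pow_le_pow_right₀ h1I0 (by norm_num)
      have h1 : I1 * I0 ≤ I0 ^ 3 :=
        le_trans (by nlinarith [mul_le_mul_of_nonneg_right hI10 hI0.le]) hI02
      have h2 : I0 ≤ I0 ^ 3 := le_self_pow₀ h1I0 (by norm_num)
      have h3 : I1 * I1 ≤ I0 ^ 3 :=
        le_trans (by nlinarith [mul_le_mul hI10 hI10 hI1.le hI0.le]) hI02
      have hE2 : E ^ 2 ≤ E ^ 3 := pow_le_pow_right₀ hE1 (by norm_num)
      have hX : 0 ≤ I1 ^ w := hI1w.le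
      have hX3 : 0 ≤ I1 ^ w * I0 ^ 3 := by positivity
      have t1 : 2 * E ^ 2 * (I1 ^ w * (I1 * I0)) ≤ 2 * E ^ 3 * (I1 ^ w * I0 ^ 3) :=
        mul_le_mul (by linarith) (mul_le_mul_of_nonneg_left h1 hX) (by positivity) (by positivity)
      have t2 : (w + 2) * E ^ 3 * (I1 ^ w * I0) ≤ (w + 2) * E ^ 3 * (I1 ^ w * I0 ^ 3) :=
        mul_le_mul_of_nonneg_left (mul_le_mul_of_nonneg_left h2 hX) (by positivity)
      have t3 : 2 * E ^ 2 * (I1 ^ w * (I1 * I1)) ≤ 2 * E ^ 3 * (I1 ^ w * I0 ^ 3) :=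
        mul_le_mul (by linarith) (mul_le_mul_of_nonneg_left h3 hX) (by positivity) (by positivity)
      calc |R * I0 - 2 * κ 0 * Z'|
          ≤ (I1 ^ (w + 1) * (2 * E) * E + I1 ^ w * ((w + 2) * E ^ 2) * E) * I0 + 2 * E * (I1 ^ (w + 2) * E) :=
            hnum
        _ = 2 * E ^ 2 * (I1 ^ w * (I1 * I0)) + (w + 2) * E ^ 3 * (I1 ^ w * I0) +
              2 * E ^ 2 * (I1 ^ w * (I1 * I1)) := by rw [add_mul, e1, e2, e3]
        _ ≤ 2 * E ^ 3 * (I1 ^ w * I0 ^ 3) + (w + 2) * E ^ 3 * (I1 ^ w * I0 ^ 3) +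
              2 * E ^ 3 * (I1 ^ w * I0 ^ 3) := add_le_add (add_le_add t1 t2) t3
        _ = ((w : ℝ) + 6) * E ^ 3 * I1 ^ w * I0 ^ 3 := by ring
    have hB1 : ((w : ℝ) + 6) * E ^ 3 * I1 ^ w * I0 ^ 3 * (4 * π ^ 2 * I0 ^ w) =
        ((w + 3 : ℝ) + 3) * E ^ 3 * I1 ^ w * (4 * π ^ 2 * I0 ^ (w + 3)) := by ring
    have hB2 : I0 ^ (w + 3) ≤ (I0 ^ (w + 3) + Z') * I0 :=
      le_trans (le_mul_of_one_le_right (pow_nonneg hI0.le _) h1I0) hden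
    calc |R * I0 - 2 * κ 0 * Z'| * (4 * π ^ 2 * I0 ^ w)
        ≤ ((w : ℝ) + 6) * E ^ 3 * I1 ^ w * I0 ^ 3 * (4 * π ^ 2 * I0 ^ w) :=
          mul_le_mul_of_nonneg_right hA (by positivity)
      _ = ((w + 3 : ℝ) + 3) * E ^ 3 * I1 ^ w * (4 * π ^ 2 * I0 ^ (w + 3)) := hB1
      _ ≤ ((w + 3 : ℝ) + 3) * E ^ 3 * I1 ^ w * (4 * π ^ 2 * ((I0 ^ (w + 3) + Z') * I0)) :=
          mul_le_mul_of_nonneg_left (mul_le_mul_of_nonneg_left hB2 (by positivity)) (by positivity)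
  -- divide `key` by `I0^w`
  have hfin : |R * I0 - 2 * κ 0 * Z'| * (4 * π ^ 2) ≤
      ((w + 3 : ℝ) + 3) * E ^ 3 * (I1 ^ w / I0 ^ w) * (4 * π ^ 2 * ((I0 ^ (w + 3) + Z') * I0)) := by
    rw [show ((w + 3 : ℝ) + 3) * E ^ 3 * (I1 ^ w / I0 ^ w) * (4 * π ^ 2 * ((I0 ^ (w + 3) + Z') * I0)) =
      (((w + 3 : ℝ) + 3) * E ^ 3 * I1 ^ w * (4 * π ^ 2 * ((I0 ^ (w + 3) + Z') * I0))) / I0 ^ w by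
      field_simp]
    rw [le_div_iff₀ hI0w]
    calc |R * I0 - 2 * κ 0 * Z'| * (4 * π ^ 2) * I0 ^ w = |R * I0 - 2 * κ 0 * Z'| * (4 * π ^ 2 * I0 ^ w) := by
          ring
      _ ≤ _ := key
  linarith [hfin]

/-- **`χ_∞(β) = ⟨θ²⟩_β/(4π²)`**: the limit value is the second moment of a single plaquette angle
(density `∝ e^{β cos θ}` on `[−π, π]`) in units of `2π`:
`1/12 + κ_0(β)/(2π² I₀(β)) = (∫_{−π}^{π} θ² e^{β cos θ} dθ)/(4π² · 2π I₀(β))`. -/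
theorem chiInf_eq_single_plaquette {β : ℝ} (hβ : 0 < β) :
    1 / 12 + (∑' m : ℤ, besselI m.natAbs β * ((-1 : ℝ) ^ ((0 : ℤ) + m) / (((0 : ℤ) + m : ℤ) : ℝ) ^ 2)) /
        (2 * π ^ 2 * besselI 0 β) =
      (∫ v in (-π)..π, v ^ 2 * Real.exp (β * Real.cos v)) / (4 * π ^ 2 * (2 * π * besselI 0 β)) := by
  have hI0 : 0 < besselI 0 β := besselI_pos 0 hβ
  have hπ : (π : ℝ) ≠ 0 := Real.pi_pos.ne'
  have h := cosMoment_eq_tsum β 0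
  simp only [Int.cast_zero, zero_mul, Real.cos_zero, mul_one, Int.natAbs_zero] at h
  rw [h]
  field_simp
  ring

/-- **`χ_t(L + 2, β) → χ_∞(β)` as `L → ∞`** (`β > 0`). -/
theorem tendsto_u1TopSusceptibility {β : ℝ} (hβ : 0 < β) :
    Tendsto (fun L : ℕ => u1TopSusceptibility (L + 2) β) atTop
      (𝓝 (1 / 12 + (∑' m : ℤ, besselI m.natAbs β * ((-1 : ℝ) ^ ((0 : ℤ) + m) / (((0 : ℤ) + m : ℤ) : ℝ) ^ 2)) /
        (2 * π ^ 2 * besselI 0 β))) := by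
  set c := 1 / 12 + (∑' m : ℤ, besselI m.natAbs β * ((-1 : ℝ) ^ ((0 : ℤ) + m) / (((0 : ℤ) + m : ℤ) : ℝ) ^ 2)) /
        (2 * π ^ 2 * besselI 0 β) with hc
  set t := besselI 1 β / besselI 0 β with ht
  have hI0 : 0 < besselI 0 β := besselI_pos 0 hβ
  have ht0 : 0 ≤ t := div_nonneg (besselI_pos 1 hβ).le hI0.le
  have ht1 : t < 1 := (div_lt_one hI0).2 (besselI_succ_lt 0 hβ)
  -- the bound `B(V) = (V+3) e^{3β} t^{V−3}/(4π²)` along `V = (L+2)²` tends to `0`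
  have hlim : Tendsto (fun n : ℕ => ((n : ℝ) + 6) * t ^ n) atTop (𝓝 0) := by
    have h1 := tendsto_self_mul_const_pow_of_lt_one ht0 ht1
    have h2 := (tendsto_pow_atTop_nhds_zero_of_lt_one ht0 ht1).const_mul 6
    simpa [add_mul] using h1.add h2
  have hV : Tendsto (fun L : ℕ => (L + 2) ^ 2 - 3) atTop atTop := by
    refine tendsto_atTop_mono (fun L => ?_) tendsto_id
    have : L ≤ (L + 2) ^ 2 - 3 := by
      have h : (L + 2) ^ 2 = L ^ 2 + 4 * L + 4 := by ring
      omega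
    simpa using this
  have hB : Tendsto (fun L : ℕ => (((((L + 2) ^ 2 - 3 : ℕ) : ℝ)) + 6) * t ^ ((L + 2) ^ 2 - 3)) atTop (𝓝 0) :=
    hlim.comp hV
  have hB' : Tendsto (fun L : ℕ => ((((L + 2 : ℕ) : ℝ)) ^ 2 + 3) * Real.exp (3 * β) *
      t ^ ((L + 2) ^ 2 - 3) / (4 * π ^ 2)) atTop (𝓝 0) := by
    have := (hB.mul_const (Real.exp (3 * β) / (4 * π ^ 2)))
    rw [zero_mul] at this
    refine this.congr fun L => ?_
    have hc' : ((((L + 2) ^ 2 - 3 : ℕ) : ℝ)) = (((L + 2 : ℕ) : ℝ)) ^ 2 - 3 := by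
      have h3 : 3 ≤ (L + 2) ^ 2 :=
        le_trans (by norm_num) (Nat.pow_le_pow_left (by omega : 2 ≤ L + 2) 2)
      rw [Nat.cast_sub h3]; push_cast; ring
    rw [hc']; ring
  refine tendsto_const_nhds.congr_dist (squeeze_zero (fun _ => dist_nonneg) (fun L => ?_) hB')
  rw [dist_comm, Real.dist_eq]
  haveI : NeZero (L + 2) := ⟨by omega⟩
  exact abs_u1TopSusceptibility_sub_le hβ (by omega)

end Summit.Ventures.LatticeQCDFlow.Scoring
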